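/-
Copyright: public-audit package `pub-balaban` (b2b-balaban), seat pv28-g7. Released under Apache 2.0 like Mathlib.
-/
import Literature.MathematicalPhysics.QuantumFieldTheory.Balaban1983to89.T4TiltOscillation
import Literature.MathematicalPhysics.QuantumFieldTheory.Balaban1983to89.T4CondLawRelative

/-!
# T4TiltOscillationRel — the explicit `κ(u)`, `ε(u)` of `T4TiltOscillation` IN THE RELATIVE FIBRE COORDINATE of
# `T4CondLawRelative`: the algebraic half of caveat (COORD) (cell `pub-balaban`, T4-DAG v10 §5; self-proposed kernel
# sub-row T4-O3.E-iii-b-G7-LOGREL* of the pv28 lineage, gen 7, below this lineage's T4-O3.E-iii-b-G7-LOG*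
# (`T4TiltOscillation`) and pv04-g10's T4-O3.E-i-α-RELCOORD* (`T4CondLawRelative`); kernel bookkeeping, Mathlib +
# two cell modules BY NAME)

HONEST FRAMING (cell `pub-balaban`, T4-DAG PAGE 1).  The cell's T4 target is the existence AND uniqueness of the
continuum limit of Bałaban's unit-scale averaged loop expectations on a finite torus — a constructive-QFT statement
strictly beyond ultraviolet stability ([Balaban1989LargeFieldII] Thm 1 p. 355); it is NOT the Yang–Mills mass gap and
NOT the Clay problem.  This module is ELEMENTARY and asserts NOTHING about Bałaban's papers: no statement of the series
B1–B16 is quoted, used or typed here, and no estimate of the series is proved.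

WHAT IT DOES.  `T4TiltOscillation` (this lineage) computes the free constant `κ(u)` and the oscillation `ε(u)` of the
Gibbs-tilt input `|h(u←y) − h(u₀←y) − κ| ≤ ε` of pv16-g9's `T4TiltModulus` for Wilson-type exponents
`h(U) = Σ_i c_i Re tr U(w_i)` in the RAW fibre coordinate `y = V⌈_s`.  pv04-g10's `T4CondLawRelative` located (by
definition, `T4DressingDefect.condLaw`) that the printed fibre variable is the RELATIVE one, `V′ = V(V^{(k)})⁻¹`
([Balaban1987RG1] p. 265) / `V′_k = V_k(V_Λ)⁻¹` ([Balaban1989LargeFieldII] p. 378): on the fibre through the exterior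
`u` the configuration reads `u←(y′·vΛ(u)⌈_s)` for a background functional `vΛ` with `T4FibreTranslate.FieldIndep s vΛ`
(`relDensity`, `relDensity_updateFinset`), the printed windows read `V′` alone (`relWindow`, exterior-blind in the
relative coordinate BY CONSTRUCTION, `relWindow_updateFinset_mul`), and the tilt input becomes the oscillation of the
exponent ALONG RELATIVE FIBRES, `|h(u←y′·vΛ(u)⌈_s) − h(u₀←y′·vΛ(u₀)⌈_s) − κ| ≤ ε` (`fibreRatioClose_relWindow_exp`);
its hand-over note (CLAIMS.log 2026-08-19T03:04:09Z) to this lineage: «the changed letters of your word expansion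
include, besides the exterior bonds `b ∉ s`, the BACKGROUND FACTORS `(V_Λ(u))_b` vs `(V_Λ(u₀))_b` on the fibre bonds
`b ∈ s`».  THIS MODULE TYPES EXACTLY THAT: the relative reading of a word is again a lettered word of
`T4TiltOscillation` §2 — a fibre letter `(b,+)` reads `y′_b · v_b` = (fibre factor `y′_b`, new factor `v_b = vΛ(u)_b`,
old factor `v⁰_b = vΛ(u₀)_b`), an inverse fibre letter `(b,−)` reads `v_b⁻¹ y′_b⁻¹` whose deviation
`y′_b (v⁰_b v_b⁻¹) y′_b⁻¹` has the SAME `dist1` and `reTr` as `(v⁰_b)⁻¹ v_b` by conjugation invariance (`dist1_conj`,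
`reTr_conj` of the interface) — so the word expansion lemma `abs_reTr_wNew_sub_le'` applies BY NAME and yields
`κ`, `ε` as explicit finite sums in which every fibre letter of a word meeting `s` contributes the BACKGROUND
DEVIATION `(vΛ(u₀)_b)⁻¹ vΛ(u)_b` exactly as an exterior letter contributes `u₀(b)⁻¹ u(b)`; both are independent of
`y′`.  NEW RELATIVE TO THE RAW READING: a word INSIDE the fibre region (all letters in `s`), which contributes nothing
to the raw `eps`, now carries the background deviations of its letters — on the relative reading EVERY plaquette
meeting `s` enters `ε`, not only the boundary ones.  The raw reading is the instance `v = v⁰` (`rdev_bg_self`,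
`rkappa_bg_self`, `reps_bg_self`; pv04's `relDensity_one`).  Complementary consumer (not imported, nothing of it
used): pv16-g10's `T4TiltModulusRelative` (row T4-O3.E-i′-β-RELTILT*) turns membership in
`tiltDom s (relDensity s vΛ old) u₀ κ ε ε₀` — the output below — into mean-field Lipschitz moduli for relative inserts.
OUTPUT, by name: `u ∈ tiltDom s (relDensity s vΛ old) u₀ (rkappa …) (reps …) ε₀` for `old = χ·e^{h}` with a window
exterior-blind along relative fibres (`mem_tiltDom_rel_hsum`), for `old = relWindow s vΛ w · e^{−βA_w}`
(`mem_tiltDom_relWindow_wilsonAction`), and a FULLY EXPLICIT instance — the sharp relative fibre window times the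
Wilson Gibbs factor in `SU(n)` (`mem_tiltDom_relFibreWindow_wilson_SU`).  Every declaration is `[folklore]`.  Value:
kernel lemma + bookkeeping of an implication ⇐ named inputs; NOT summit progress.

## The mechanism (R1)–(R3), as typed here

* (R1) §1, RELATIVE LETTERS.  `rbdev s u u₀ v v⁰ b = (v⁰_b)⁻¹ v_b` on fibre bonds, `u₀(b)⁻¹ u(b)` on exterior bonds;
  `rdev` / `rkap` = the letter sums of `dist1 (rbdev ·)` / `reTr (rbdev ·) − 1` over a word (independent of the fibre
  value `y′`); `relTriple` presents the relative reading as a lettered word; four bridges to `wNew` / `wOld` / `wDev` /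
  `wKap`; the PER-WORD BOUND `abs_reTr_wordHol_rel_sub_le`:
  `|reTr (u←y′v)(w) − reTr (u₀←y′v⁰)(w) − rkap| ≤ dist1((u₀←y′v⁰)(w))·rdev + rdev²/2`.
* (R2) §2, FINITE FAMILIES.  `rkappa`, `reps` (words missing the fibre absorbed EXACTLY by `rkappa`, as in the raw
  module) and THE RELATIVE OSCILLATION THEOREM `abs_hsum_rel_sub_le`; `reps ≥ 0`, `reps(u₀,u₀,v⁰,v⁰) = 0`, the raw
  instances `v = v⁰`, and the coarse sizing `reps_le_of_rbdev_le` — FIRST ORDER in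
  `D := max(exterior deviation, background deviation)` with coefficient `Σ_{w_i meets s} |c_i| η_i |w_i|` — the
  sum over ALL words meeting `s`, interior ones included (`rbdev_le_of_bdev_le` splits the letterwise hypothesis
  into its exterior and background parts).
* (R3) §3, DISCHARGE BY NAME of pv04's / pv16's objects.  Support-restricted twins
  `fibreRatioClose_relDensity_of_exp_on` / `fibreRatioClose_relWindow_exp_on` of pv04's suppliers (the exponent
  hypothesis only on the window support; pv04's all-`y′` versions untouched); the `u`-independent window hypothesis
  `SmallOnRelWindow` with two suppliers (by support; letterwise with `η_i = |w_i|·(r + r₀)`, `r` the fibre/exterior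
  radius, `r₀` a bound for the reference background `vΛ(u₀)` on the fibre letters); `fibreRatioClose_rel_hsum`,
  `mem_tiltDom_rel_hsum`, the `relWindow` forms, the Wilson forms, and the explicit instances
  `mem_tiltDom_relFibreWindow_wilson` / `…_SU`.

## WHAT IS NOT PROVED / NOT PRINTED (record `t4/T4-EST-O3Eiiib-G7.md` § «G7-T» (T-c)/(T-d) of this lineage;
pv04-g10's `T4CondLawRelative` header (A)–(E); pv16-g9's `T4TiltModulus` caveats (S-TILT), (LOG), (B-INS), (SUP))

* (LOG-SIZE-REL) NO SIZING: the background deviations `|vΛ(u₀)_b⁻¹ vΛ(u)_b − 1|`, `b ∈ s`, entering `reps` — one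
  term per fibre letter of EVERY plaquette meeting `s`, the plaquettes inside the fibre region included, so that the
  count is the number of plaquettes meeting `s` (a volume, not a boundary) — are a REGULARITY INPUT on Bałaban's
  background configurations (`V_Λ = M^k(U₀)` of [Balaban1989LargeFieldI] p. 197: the dependence of the minimisers on
  the exterior field across the block — a B12 (1.78)/(1.83)-type statement in pv04-g10's wording), NOT estimated here
  and NOT asserted to be printed in the needed form (summability against `g_k^{−2}` uniformly in `k` would need that
  dependence to DECAY away from the support of the exterior change — not typed, not asserted); nor is the exterior
  deviation, the window radius or the plaquette count sized against `g_k^{−2}` (GAPS G-pv28g7-1 of this lineage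
  stands, now with the background term: G-pv28g7-2).  `reps_le_of_rbdev_le` is parameter-free.
* Existence, measurability and `FieldIndep` of Bałaban's `V_Λ`, `V^{(k)}` are HYPOTHESES (`hv : FieldIndep s vΛ`) —
  U1a inputs of the DAG, exactly as in `T4FibreTranslate` / `T4CondLawRelative`; the δ-function factors of the printed
  densities are not modelled (F7 standing).
* The (B-INS) cost `D` of pv04's `norm_integral_condLaw_sub_le_relative` (an exterior-independent insert read through
  the moving background) is a SEPARATE input of that theorem, untouched here: this module supplies only its
  `FibreRatioClose s (relDensity s vΛ old) u u₀ κ ε` hypothesis, with `κ`, `ε` explicit.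
* `ReTrQuad G` stays the hypothesis SHAPE of `T4TiltOscillation` §1, discharged there for `U(n)` / `SU(n)`.

Depends on `T4TiltOscillation` (this lineage: `ReTrQuad`, the word calculus `wNew`/`wOld`/`wDev`/`wKap`/`ldev`,
`abs_reTr_wNew_sub_le'`, `Letter`/`letter`/`wordHol`/`plaqWord`/`bdev`/`wdev`/`wkap`, `hsum`/`Meets`/`kappa`/`eps`,
`exp_neg_mul_wilsonAction`, `ratioClose_of_exp_on`, `sum_map_le_length_mul`, `dist1_wordHol_le`,
`reTrQuad_specialUnitaryGroup`), `T4CondLawRelative` (pv04-g10: `onFibre`, `relDensity`, `relDensity_updateFinset`,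
`relWindow`, `relWindow_updateFinset_mul`), `T4FibreTranslate` (b01/pv04: `FieldIndep`), `T4TiltModulus` (pv16-g9:
`RatioClose`, `fibreDensity`, `FibreRatioClose`, `tiltDom`), `Setup` and Mathlib (`Function.updateFinset`,
`Finset.abs_sum_le_sum_abs`, `pow_le_pow_left₀`, tactic `group`).  All declarations [folklore]; no `[cite:]`.
v1 (this file): new leaf, no declaration of another module changed.
-/

noncomputable section

open Function (updateFinset)
open scoped BigOperators

namespace Literature.MathematicalPhysics.QuantumFieldTheory.Balaban1983to89.T4TiltOscillationRel

open Literature.MathematicalPhysics.QuantumFieldTheory.Balaban1983to89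
open Literature.MathematicalPhysics.QuantumFieldTheory.Balaban1983to89.T4TiltModulus
open Literature.MathematicalPhysics.QuantumFieldTheory.Balaban1983to89.T4TiltOscillation
open Literature.MathematicalPhysics.QuantumFieldTheory.Balaban1983to89.T4FibreTranslate (FieldIndep)
open Literature.MathematicalPhysics.QuantumFieldTheory.Balaban1983to89.T4CondLawRelative

/-! ## §0  Two conjugation identities on the interface -/

section Elementary

variable {G : Type*} [GaugeGroup G]

/-- The deviation of an inverse relative fibre letter: `((x⁰)⁻¹ y⁻¹)⁻¹ (x⁻¹ y⁻¹) = y (x⁰ x⁻¹) y⁻¹`. [folklore] -/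
theorem ldev_inv_letter (x x₀ y : G) : (x₀⁻¹ * y⁻¹)⁻¹ * (x⁻¹ * y⁻¹) = y * (x₀ * x⁻¹) * y⁻¹ := by
  group

/-- … whose distance to `1` is that of `(x⁰)⁻¹ x` (`dist1_conj`, `dist1_mul_inv_eq`). [folklore] -/
theorem dist1_ldev_inv_letter (x x₀ y : G) : dist1 ((x₀⁻¹ * y⁻¹)⁻¹ * (x⁻¹ * y⁻¹)) = dist1 (x₀⁻¹ * x) := by
  rw [ldev_inv_letter, GaugeGroup.dist1_conj, dist1_mul_inv_eq]

/-- … and whose real trace is that of `(x⁰)⁻¹ x` (`reTr_conj`, `reTr_mul_inv_eq`). [folklore] -/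
theorem reTr_ldev_inv_letter (x x₀ y : G) : reTr ((x₀⁻¹ * y⁻¹)⁻¹ * (x⁻¹ * y⁻¹)) = reTr (x₀⁻¹ * x) := by
  rw [ldev_inv_letter, GaugeGroup.reTr_conj, reTr_mul_inv_eq]

end Elementary

/-! ## §1  Relative letters: the relative reading of a word is a lettered word -/

section Word

variable {P : Params} {j : ℕ} {G : Type*} [GaugeGroup G] [DecidableEq (PBond P j)]

/-- THE RELATIVE BOND DEVIATION: on a fibre bond the BACKGROUND deviation `(v⁰_b)⁻¹ v_b`, on an exterior bond the
exterior deviation `u₀(b)⁻¹ u(b)` (`T4TiltOscillation.bdev`). [folklore] -/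
def rbdev (s : Finset (PBond P j)) (u u₀ v v₀ : GaugeField P j G) (b : PBond P j) : G :=
  if b ∈ s then bdev v v₀ b else bdev u u₀ b

/-- On a fibre bond: the background deviation. [folklore] -/
theorem rbdev_of_mem (s : Finset (PBond P j)) (u u₀ v v₀ : GaugeField P j G) {b : PBond P j} (hb : b ∈ s) :
    rbdev s u u₀ v v₀ b = (v₀ b)⁻¹ * v b := by
  rw [rbdev, if_pos hb, bdev]

/-- On an exterior bond: the exterior deviation. [folklore] -/
theorem rbdev_of_not_mem (s : Finset (PBond P j)) (u u₀ v v₀ : GaugeField P j G) {b : PBond P j} (hb : b ∉ s) :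
    rbdev s u u₀ v v₀ b = bdev u u₀ b := by
  rw [rbdev, if_neg hb]

/-- EQUAL BACKGROUNDS (in particular the raw reading `v = v⁰ = 1`): the fibre bonds do not deviate. [folklore] -/
theorem rbdev_bg_self (s : Finset (PBond P j)) (u u₀ v : GaugeField P j G) (b : PBond P j) :
    rbdev s u u₀ v v b = if b ∈ s then 1 else bdev u u₀ b := by
  unfold rbdev bdev
  split_ifs <;> simp

/-- SPLITTING a letterwise bound: exterior deviation `≤ D` on the exterior bonds and background deviation `≤ D` on the
fibre bonds give `dist1 (rbdev …) ≤ D`. [folklore] -/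
theorem rbdev_le_of_bdev_le (s : Finset (PBond P j)) (u u₀ v v₀ : GaugeField P j G) {b : PBond P j} {D : ℝ}
    (hext : b ∉ s → dist1 (bdev u u₀ b) ≤ D) (hbg : b ∈ s → dist1 ((v₀ b)⁻¹ * v b) ≤ D) :
    dist1 (rbdev s u u₀ v v₀ b) ≤ D := by
  by_cases hb : b ∈ s
  · rw [rbdev_of_mem s u u₀ v v₀ hb]; exact hbg hb
  · rw [rbdev_of_not_mem s u u₀ v v₀ hb]; exact hext hb

/-- THE RELATIVE DEVIATION of a word: `Σ_{letters} dist1 (rbdev …)` — fibre letters contribute the background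
deviation, exterior letters the exterior deviation; independent of the fibre value. [folklore] -/
def rdev (s : Finset (PBond P j)) (u u₀ v v₀ : GaugeField P j G) (w : List (Letter P j)) : ℝ :=
  (w.map fun c => dist1 (rbdev s u u₀ v v₀ c.1)).sum

/-- THE RELATIVE CONSTANT of a word: `Σ_{letters} (reTr (rbdev …) − 1)`. [folklore] -/
def rkap (s : Finset (PBond P j)) (u u₀ v v₀ : GaugeField P j G) (w : List (Letter P j)) : ℝ :=
  (w.map fun c => reTr (rbdev s u u₀ v v₀ c.1) - 1).sum

/-- `rdev` of the empty word is `0`. [folklore] -/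
@[simp] theorem rdev_nil (s : Finset (PBond P j)) (u u₀ v v₀ : GaugeField P j G) : rdev s u u₀ v v₀ [] = 0 := by
  simp [rdev]

/-- `rdev` of a cons: the head letter's `dist1 (rbdev …)` plus the tail's `rdev`. [folklore] -/
theorem rdev_cons (s : Finset (PBond P j)) (u u₀ v v₀ : GaugeField P j G) (c : Letter P j) (w : List (Letter P j)) :
    rdev s u u₀ v v₀ (c :: w) = dist1 (rbdev s u u₀ v v₀ c.1) + rdev s u u₀ v v₀ w := by
  simp [rdev]

/-- `rkap` of the empty word is `0`. [folklore] -/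
@[simp] theorem rkap_nil (s : Finset (PBond P j)) (u u₀ v v₀ : GaugeField P j G) : rkap s u u₀ v v₀ [] = 0 := by
  simp [rkap]

/-- `rkap` of a cons: the head letter's `reTr (rbdev …) − 1` plus the tail's `rkap`. [folklore] -/
theorem rkap_cons (s : Finset (PBond P j)) (u u₀ v v₀ : GaugeField P j G) (c : Letter P j) (w : List (Letter P j)) :
    rkap s u u₀ v v₀ (c :: w) = (reTr (rbdev s u u₀ v v₀ c.1) - 1) + rkap s u u₀ v v₀ w := by
  simp [rkap]

/-- `0 ≤ rdev`. [folklore] -/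
theorem rdev_nonneg (s : Finset (PBond P j)) (u u₀ v v₀ : GaugeField P j G) (w : List (Letter P j)) :
    0 ≤ rdev s u u₀ v v₀ w := by
  induction w with
  | nil => simp
  | cons c w ih =>
    rw [rdev_cons]
    exact add_nonneg (GaugeGroup.dist1_nonneg _) ih

/-- EQUAL BACKGROUNDS: the relative deviation is the raw one (`T4TiltOscillation.wdev`). [folklore] -/
theorem rdev_bg_self (s : Finset (PBond P j)) (u u₀ v : GaugeField P j G) (w : List (Letter P j)) :
    rdev s u u₀ v v w = wdev s u u₀ w := by
  induction w with
  | nil => simp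
  | cons c w ih =>
    rw [rdev_cons, wdev_cons, ih, rbdev_bg_self]
    congr 1
    split_ifs <;> simp [GaugeGroup.dist1_one]

/-- EQUAL BACKGROUNDS: the relative constant is the raw one (`T4TiltOscillation.wkap`). [folklore] -/
theorem rkap_bg_self (s : Finset (PBond P j)) (u u₀ v : GaugeField P j G) (w : List (Letter P j)) :
    rkap s u u₀ v v w = wkap s u u₀ w := by
  induction w with
  | nil => simp
  | cons c w ih =>
    rw [rkap_cons, wkap_cons, ih, rbdev_bg_self]
    congr 1
    split_ifs <;> simp [GaugeGroup.reTr_one]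

/-- Under a letterwise bound `dist1 (rbdev …) ≤ D` on the letters of `w`: `rdev ≤ |w|·D`. [folklore] -/
theorem rdev_le_length_mul (s : Finset (PBond P j)) (u u₀ v v₀ : GaugeField P j G) (w : List (Letter P j)) {D : ℝ}
    (hD : ∀ c ∈ w, dist1 (rbdev s u u₀ v v₀ c.1) ≤ D) : rdev s u u₀ v v₀ w ≤ w.length * D :=
  sum_map_le_length_mul w _ hD

/-- THE RELATIVE LETTER TRIPLE `(fibre factor, new factor, old factor)` of `T4TiltOscillation` §2: a fibre letter
`(b,+)` reads `(y′_b, v_b, v⁰_b)`, an inverse fibre letter `(b,−)` reads `(1, v_b⁻¹ y′_b⁻¹, (v⁰_b)⁻¹ y′_b⁻¹)`, an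
exterior letter `(1, u(b)^{±1}, u₀(b)^{±1})`. [folklore] -/
def relTriple (s : Finset (PBond P j)) (u u₀ v v₀ : GaugeField P j G) (y : s → G) : Letter P j → G × G × G
  | (b, true) => if h : b ∈ s then (y ⟨b, h⟩, v b, v₀ b) else (1, u b, u₀ b)
  | (b, false) => if h : b ∈ s then (1, (v b)⁻¹ * (y ⟨b, h⟩)⁻¹, (v₀ b)⁻¹ * (y ⟨b, h⟩)⁻¹) else (1, (u b)⁻¹, (u₀ b)⁻¹)

/-- BRIDGE: the new word is the holonomy at `u←(y′·v⌈_s)`. [folklore] -/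
theorem wNew_relTriple (s : Finset (PBond P j)) (u u₀ v v₀ : GaugeField P j G) (y : s → G) (w : List (Letter P j)) :
    wNew (w.map (relTriple s u u₀ v v₀ y)) = wordHol (updateFinset u s (y * onFibre s v)) w := by
  induction w with
  | nil => simp
  | cons c w ih =>
    obtain ⟨b, o⟩ := c
    rw [List.map_cons, wNew_cons, wordHol_cons, ih]
    congr 1
    by_cases hb : b ∈ s
    · cases o <;>
        simp [relTriple, hb, letter, updateFinset_apply_of_mem u (y * onFibre s v) hb, Pi.mul_apply, onFibre_apply,
          mul_inv_rev]
    · cases o <;> simp [relTriple, hb, letter, updateFinset_apply_of_not_mem u (y * onFibre s v) hb]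

/-- BRIDGE: the old word is the holonomy at `u₀←(y′·v⁰⌈_s)`. [folklore] -/
theorem wOld_relTriple (s : Finset (PBond P j)) (u u₀ v v₀ : GaugeField P j G) (y : s → G) (w : List (Letter P j)) :
    wOld (w.map (relTriple s u u₀ v v₀ y)) = wordHol (updateFinset u₀ s (y * onFibre s v₀)) w := by
  induction w with
  | nil => simp
  | cons c w ih =>
    obtain ⟨b, o⟩ := c
    rw [List.map_cons, wOld_cons, wordHol_cons, ih]
    congr 1
    by_cases hb : b ∈ s
    · cases o <;>
        simp [relTriple, hb, letter, updateFinset_apply_of_mem u₀ (y * onFibre s v₀) hb, Pi.mul_apply, onFibre_apply,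
          mul_inv_rev]
    · cases o <;> simp [relTriple, hb, letter, updateFinset_apply_of_not_mem u₀ (y * onFibre s v₀) hb]

/-- BRIDGE: the total deviation of the relative lettered word is `rdev` (inverse fibre letters by
`dist1_ldev_inv_letter`, inverse exterior letters by `dist1_mul_inv_eq`). [folklore] -/
theorem wDev_relTriple (s : Finset (PBond P j)) (u u₀ v v₀ : GaugeField P j G) (y : s → G) (w : List (Letter P j)) :
    wDev (w.map (relTriple s u u₀ v v₀ y)) = rdev s u u₀ v v₀ w := by
  induction w with
  | nil => simp
  | cons c w ih =>
    obtain ⟨b, o⟩ := c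
    rw [List.map_cons, wDev_cons, rdev_cons, ih]
    congr 1
    by_cases hb : b ∈ s
    · cases o
      · simp only [relTriple, hb, dite_true, ldev, rbdev_of_mem s u u₀ v v₀ hb, dist1_ldev_inv_letter]
      · simp only [relTriple, hb, dite_true, ldev, rbdev_of_mem s u u₀ v v₀ hb]
    · cases o <;> simp [relTriple, hb, ldev, rbdev_of_not_mem s u u₀ v v₀ hb, bdev, dist1_mul_inv_eq]

/-- BRIDGE: the constant of the relative lettered word is `rkap`. [folklore] -/
theorem wKap_relTriple (s : Finset (PBond P j)) (u u₀ v v₀ : GaugeField P j G) (y : s → G) (w : List (Letter P j)) :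
    wKap (w.map (relTriple s u u₀ v v₀ y)) = rkap s u u₀ v v₀ w := by
  induction w with
  | nil => simp
  | cons c w ih =>
    obtain ⟨b, o⟩ := c
    rw [List.map_cons, wKap_cons, rkap_cons, ih]
    congr 2
    by_cases hb : b ∈ s
    · cases o
      · simp only [relTriple, hb, dite_true, ldev, rbdev_of_mem s u u₀ v v₀ hb, reTr_ldev_inv_letter]
      · simp only [relTriple, hb, dite_true, ldev, rbdev_of_mem s u u₀ v v₀ hb]
    · cases o <;> simp [relTriple, hb, ldev, rbdev_of_not_mem s u u₀ v v₀ hb, bdev, reTr_mul_inv_eq]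

/-- **THE PER-WORD BOUND IN THE RELATIVE COORDINATE.**  Under `ReTrQuad G`:
`|reTr (u←y′v)(w) − reTr (u₀←y′v⁰)(w) − rkap_w| ≤ dist1((u₀←y′v⁰)(w))·rdev_w + rdev_w²/2`, with `rkap_w`, `rdev_w`
INDEPENDENT of `y′` (`abs_reTr_wNew_sub_le'` BY NAME on the relative lettered word). [folklore] -/
theorem abs_reTr_wordHol_rel_sub_le (hq : ReTrQuad G) (s : Finset (PBond P j)) (u u₀ v v₀ : GaugeField P j G)
    (y : s → G) (w : List (Letter P j)) :
    |reTr (wordHol (updateFinset u s (y * onFibre s v)) w) - reTr (wordHol (updateFinset u₀ s (y * onFibre s v₀)) w)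
        - rkap s u u₀ v v₀ w|
      ≤ dist1 (wordHol (updateFinset u₀ s (y * onFibre s v₀)) w) * rdev s u u₀ v v₀ w
        + rdev s u u₀ v v₀ w ^ 2 / 2 := by
  have h := abs_reTr_wNew_sub_le' hq (w.map (relTriple s u u₀ v v₀ y))
  rwa [wNew_relTriple, wOld_relTriple, wDev_relTriple, wKap_relTriple] at h

end Word

/-! ## §2  Finite families: `rkappa`, `reps` and the relative oscillation theorem -/

section Sum

variable {P : Params} {j : ℕ} {G : Type*} [GaugeGroup G] {ι : Type*} [Fintype ι] [DecidableEq (PBond P j)]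

/-- THE EXPLICIT FREE CONSTANT in the relative coordinate: words missing the fibre contribute their whole increment,
words meeting it their relative constant `rkap`. [folklore] -/
def rkappa (s : Finset (PBond P j)) (c : ι → ℝ) (word : ι → List (Letter P j)) (u u₀ v v₀ : GaugeField P j G) : ℝ :=
  ∑ i, c i * (if Meets s (word i) then rkap s u u₀ v v₀ (word i)
    else reTr (wordHol u (word i)) - reTr (wordHol u₀ (word i)))

/-- THE EXPLICIT OSCILLATION in the relative coordinate: `Σ_{w_i meets s} |c_i| (η_i·rdev_{w_i} + rdev_{w_i}²/2)`.
[folklore] -/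
def reps (s : Finset (PBond P j)) (c : ι → ℝ) (word : ι → List (Letter P j)) (η : ι → ℝ)
    (u u₀ v v₀ : GaugeField P j G) : ℝ :=
  ∑ i, if Meets s (word i) then |c i| * (η i * rdev s u u₀ v v₀ (word i) + rdev s u u₀ v v₀ (word i) ^ 2 / 2) else 0

/-- **THE RELATIVE OSCILLATION THEOREM.**  Under `ReTrQuad G`: if every word meeting the fibre has holonomy within
`η_i` of `1` at the configuration `u₀←(y′·v⁰⌈_s)`, then
`|h(u←y′·v⌈_s) − h(u₀←y′·v⁰⌈_s) − rkappa| ≤ reps`. [folklore] -/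
theorem abs_hsum_rel_sub_le (hq : ReTrQuad G) (s : Finset (PBond P j)) (c : ι → ℝ) (word : ι → List (Letter P j))
    (η : ι → ℝ) (u u₀ v v₀ : GaugeField P j G) (y : s → G)
    (hη : ∀ i, Meets s (word i) → dist1 (wordHol (updateFinset u₀ s (y * onFibre s v₀)) (word i)) ≤ η i) :
    |hsum c word (updateFinset u s (y * onFibre s v)) - hsum c word (updateFinset u₀ s (y * onFibre s v₀))
        - rkappa s c word u u₀ v v₀|
      ≤ reps s c word η u u₀ v v₀ := by
  unfold hsum rkappa reps
  rw [← Finset.sum_sub_distrib, ← Finset.sum_sub_distrib]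
  refine (Finset.abs_sum_le_sum_abs _ _).trans (Finset.sum_le_sum fun i _ => ?_)
  by_cases hm : Meets s (word i)
  · rw [if_pos hm, if_pos hm, ← mul_sub, ← mul_sub, abs_mul]
    refine mul_le_mul_of_nonneg_left ?_ (abs_nonneg _)
    have hw := rdev_nonneg s u u₀ v v₀ (word i)
    have h1 := abs_reTr_wordHol_rel_sub_le hq s u u₀ v v₀ y (word i)
    have h2 := mul_le_mul_of_nonneg_right (hη i hm) hw
    linarith
  · have hnm := forall_not_mem_of_not_meets hm
    rw [if_neg hm, if_neg hm, wordHol_updateFinset_of_forall_not_mem u (y * onFibre s v) hnm,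
      wordHol_updateFinset_of_forall_not_mem u₀ (y * onFibre s v₀) hnm, mul_sub, sub_self, abs_zero]

/-- `0 ≤ reps` (for `η ≥ 0`). [folklore] -/
theorem reps_nonneg (s : Finset (PBond P j)) (c : ι → ℝ) (word : ι → List (Letter P j)) {η : ι → ℝ}
    (hη0 : ∀ i, 0 ≤ η i) (u u₀ v v₀ : GaugeField P j G) : 0 ≤ reps s c word η u u₀ v v₀ := by
  refine Finset.sum_nonneg fun i _ => ?_
  split_ifs
  · have hw := rdev_nonneg s u u₀ v v₀ (word i)
    exact mul_nonneg (abs_nonneg _) (add_nonneg (mul_nonneg (hη0 i) hw) (by positivity))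
  · exact le_rfl

/-- EQUAL BACKGROUNDS: `reps = eps` of the raw module. [folklore] -/
theorem reps_bg_self (s : Finset (PBond P j)) (c : ι → ℝ) (word : ι → List (Letter P j)) (η : ι → ℝ)
    (u u₀ v : GaugeField P j G) : reps s c word η u u₀ v v = eps s c word η u u₀ := by
  simp [reps, eps, rdev_bg_self]

/-- EQUAL BACKGROUNDS: `rkappa = kappa` of the raw module. [folklore] -/
theorem rkappa_bg_self (s : Finset (PBond P j)) (c : ι → ℝ) (word : ι → List (Letter P j))
    (u u₀ v : GaugeField P j G) : rkappa s c word u u₀ v v = kappa s c word u u₀ := by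
  simp [rkappa, kappa, rkap_bg_self]

/-- `reps(u₀, u₀, v⁰, v⁰) = 0`: no deviation at the reference exterior with the reference background. [folklore] -/
theorem reps_self (s : Finset (PBond P j)) (c : ι → ℝ) (word : ι → List (Letter P j)) (η : ι → ℝ)
    (u₀ v₀ : GaugeField P j G) : reps s c word η u₀ u₀ v₀ v₀ = 0 := by
  rw [reps_bg_self, eps_self]

/-- `rkappa(u₀, u₀, v⁰, v⁰) = 0`. [folklore] -/
theorem rkappa_self (s : Finset (PBond P j)) (c : ι → ℝ) (word : ι → List (Letter P j))
    (u₀ v₀ : GaugeField P j G) : rkappa s c word u₀ u₀ v₀ v₀ = 0 := by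
  rw [rkappa_bg_self, kappa_self]

/-- THE COARSE SIZING: under a letterwise bound `dist1 (rbdev …) ≤ D` on the letters of the words meeting `s`
(exterior deviation AND background deviation `≤ D`, `rbdev_le_of_bdev_le`),
`reps ≤ Σ_{w_i meets s} |c_i| (η_i |w_i| D + (|w_i| D)²/2)` — first order in `D`; the sum runs over ALL words meeting
`s`, the words inside the fibre region included.  (No sizing of `D`, `η`, or of the number of words meeting `s` against
Bałaban's parameters: caveat (LOG-SIZE-REL).) [folklore] -/
theorem reps_le_of_rbdev_le (s : Finset (PBond P j)) (c : ι → ℝ) (word : ι → List (Letter P j)) {η : ι → ℝ}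
    (hη0 : ∀ i, 0 ≤ η i) (u u₀ v v₀ : GaugeField P j G) {D : ℝ}
    (hD : ∀ i, Meets s (word i) → ∀ c ∈ word i, dist1 (rbdev s u u₀ v v₀ c.1) ≤ D) :
    reps s c word η u u₀ v v₀
      ≤ ∑ i, if Meets s (word i) then |c i| * (η i * ((word i).length * D) + ((word i).length * D) ^ 2 / 2) else 0 := by
  refine Finset.sum_le_sum fun i _ => ?_
  split_ifs with hm
  · have h0 := rdev_nonneg s u u₀ v v₀ (word i)
    have h1 := rdev_le_length_mul s u u₀ v v₀ (word i) (hD i hm)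
    have h2 : rdev s u u₀ v v₀ (word i) ^ 2 ≤ ((word i).length * D) ^ 2 := pow_le_pow_left₀ h0 h1 2
    refine mul_le_mul_of_nonneg_left (add_le_add (mul_le_mul_of_nonneg_left h1 (hη0 i)) ?_) (abs_nonneg _)
    linarith
  · exact le_rfl

end Sum

/-! ## §3a  The sharp window on the relative fibre variable -/

section SharpWindow

variable {P : Params} {j : ℕ} {G : Type*} [GaugeGroup G]

open Classical in
/-- THE SHARP WINDOW ON THE RELATIVE FIBRE VARIABLE `𝟙{|y′_b − 1| ≤ r for all b ∈ s}` — the shape of (1.101) [IV]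
«χ({|(1/i) log V′(b)| < M₀ε_k for b ∈ Λ_i})», read through pv04's `relWindow` (nothing printed asserted). [folklore] -/
def sharpWindow (s : Finset (PBond P j)) (r : ℝ) (y : s → G) : ℝ :=
  if ∀ b : s, dist1 (y b) ≤ r then 1 else 0

/-- `0 ≤ 𝟙{…}`. [folklore] -/
theorem sharpWindow_nonneg (s : Finset (PBond P j)) (r : ℝ) (y : s → G) : 0 ≤ sharpWindow s r y := by
  unfold sharpWindow
  split_ifs <;> norm_num

/-- On its support the relative fibre variables are `r`-close to `1`. [folklore] -/
theorem sharpWindow_support {s : Finset (PBond P j)} {r : ℝ} {y : s → G} (h : sharpWindow s r y ≠ 0) :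
    ∀ b : s, dist1 (y b) ≤ r := by
  unfold sharpWindow at h
  by_contra hc
  exact h (if_neg hc)

end SharpWindow

/-! ## §3b  Discharge BY NAME: `FibreRatioClose` / `tiltDom` of the RELATIVE density -/

section Discharge

variable {P : Params} {j : ℕ} {G : Type*} [GaugeGroup G] {ι : Type*} [Fintype ι] [DecidableEq (PBond P j)]

omit [Fintype ι] in
/-- Support-restricted twin of pv04-g10's `fibreRatioClose_relDensity_of_exp`: the exponent hypothesis along the
relative fibres is needed only ON THE WINDOW `{χ(u₀←y′·vΛ(u₀)⌈_s) ≠ 0}`. [folklore] -/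
theorem fibreRatioClose_relDensity_of_exp_on (s : Finset (PBond P j)) {vΛ : GaugeField P j G → GaugeField P j G}
    (hv : FieldIndep s vΛ) {χ h : Density P j G} (hχ0 : ∀ U, 0 ≤ χ U) {u u₀ : GaugeField P j G} {κ ε : ℝ}
    (hχ : ∀ y : s → G,
      χ (updateFinset u s (y * onFibre s (vΛ u))) = χ (updateFinset u₀ s (y * onFibre s (vΛ u₀))))
    (hh : ∀ y : s → G, χ (updateFinset u₀ s (y * onFibre s (vΛ u₀))) ≠ 0 →
      |h (updateFinset u s (y * onFibre s (vΛ u))) - h (updateFinset u₀ s (y * onFibre s (vΛ u₀))) - κ| ≤ ε) :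
    FibreRatioClose s (relDensity s vΛ fun U => χ U * Real.exp (h U)) u u₀ κ ε := by
  intro y
  simp only [fibreDensity, relDensity_updateFinset s hv]
  rw [hχ y]
  exact ratioClose_of_exp_on (w := fun y => χ (updateFinset u₀ s (y * onFibre s (vΛ u₀))))
    (h₁ := fun y => h (updateFinset u s (y * onFibre s (vΛ u))))
    (h₂ := fun y => h (updateFinset u₀ s (y * onFibre s (vΛ u₀)))) (fun y => hχ0 _) hh y

omit [Fintype ι] in
/-- … with a window READING THE RELATIVE VARIABLE ALONE (`relWindow`, exterior-blind in the relative coordinate by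
construction): only the exponent oscillation on the support `{w ≠ 0}` is required. [folklore] -/
theorem fibreRatioClose_relWindow_exp_on (s : Finset (PBond P j)) {vΛ : GaugeField P j G → GaugeField P j G}
    (hv : FieldIndep s vΛ) {w : (s → G) → ℝ} (hw : ∀ y, 0 ≤ w y) {h : Density P j G} {u u₀ : GaugeField P j G}
    {κ ε : ℝ} (hh : ∀ y : s → G, w y ≠ 0 →
      |h (updateFinset u s (y * onFibre s (vΛ u))) - h (updateFinset u₀ s (y * onFibre s (vΛ u₀))) - κ| ≤ ε) :
    FibreRatioClose s (relDensity s vΛ fun U => relWindow s vΛ w U * Real.exp (h U)) u u₀ κ ε :=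
  fibreRatioClose_relDensity_of_exp_on s hv (χ := relWindow s vΛ w) (h := h) (fun U => hw _)
    (fun y => by rw [relWindow_updateFinset_mul s hv, relWindow_updateFinset_mul s hv])
    (fun y hy => hh y (by rwa [relWindow_updateFinset_mul s hv] at hy))

omit [Fintype ι] in
/-- THE `u`-INDEPENDENT WINDOW HYPOTHESIS in the relative coordinate: on the window at the reference exterior (read
along the relative fibre `y′ ↦ u₀←y′·vΛ(u₀)⌈_s`) every word meeting `s` has holonomy within `η_i` of `1`. [folklore] -/
def SmallOnRelWindow (s : Finset (PBond P j)) (vΛ : GaugeField P j G → GaugeField P j G) (χ : Density P j G)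
    (word : ι → List (Letter P j)) (η : ι → ℝ) (u₀ : GaugeField P j G) : Prop :=
  ∀ y : s → G, χ (updateFinset u₀ s (y * onFibre s (vΛ u₀))) ≠ 0 →
    ∀ i, Meets s (word i) → dist1 (wordHol (updateFinset u₀ s (y * onFibre s (vΛ u₀))) (word i)) ≤ η i

omit [Fintype ι] in
/-- A window supported in the `η`-small region of the words meeting `s` supplies `SmallOnRelWindow`. [folklore] -/
theorem smallOnRelWindow_of_support {s : Finset (PBond P j)} {vΛ : GaugeField P j G → GaugeField P j G}
    {χ : Density P j G} {word : ι → List (Letter P j)} {η : ι → ℝ}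
    (h : ∀ U, χ U ≠ 0 → ∀ i, Meets s (word i) → dist1 (wordHol U (word i)) ≤ η i) (u₀ : GaugeField P j G) :
    SmallOnRelWindow s vΛ χ word η u₀ :=
  fun _ hy => h _ hy

omit [Fintype ι] in
/-- LETTERWISE SUPPLIER for a window reading the relative variable alone: if `w` forces the relative fibre variables
into `{|· − 1| ≤ r}`, the reference background `vΛ(u₀)` is `r₀`-close to `1` on the fibre bonds and the reference
exterior `u₀` is `r`-close to `1` on the exterior letters of the words meeting `s` (`0 ≤ r`, `0 ≤ r₀`), then
`SmallOnRelWindow` holds with `η_i = |w_i|·(r + r₀)` (`dist1_wordHol_le`, `dist1_mul_le`). [folklore] -/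
theorem smallOnRelWindow_of_bondSmall {s : Finset (PBond P j)} {vΛ : GaugeField P j G → GaugeField P j G}
    (hv : FieldIndep s vΛ) {w : (s → G) → ℝ} {word : ι → List (Letter P j)} {r r₀ : ℝ} (hr0 : 0 ≤ r₀)
    (hfib : ∀ y, w y ≠ 0 → ∀ b : s, dist1 (y b) ≤ r) {u₀ : GaugeField P j G}
    (hbg : ∀ b ∈ s, dist1 (vΛ u₀ b) ≤ r₀)
    (hext : ∀ i, Meets s (word i) → ∀ c ∈ word i, c.1 ∉ s → dist1 (u₀ c.1) ≤ r) :
    SmallOnRelWindow s vΛ (relWindow s vΛ w) word (fun i => (word i).length * (r + r₀)) u₀ := by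
  intro y hy i hi
  rw [relWindow_updateFinset_mul s hv] at hy
  refine (dist1_wordHol_le _ _).trans (sum_map_le_length_mul _ _ fun c hc => ?_)
  by_cases hc1 : c.1 ∈ s
  · rw [updateFinset_apply_of_mem u₀ (y * onFibre s (vΛ u₀)) hc1, Pi.mul_apply, onFibre_apply]
    have h1 := hfib y hy ⟨c.1, hc1⟩
    have h2 := hbg c.1 hc1
    exact (GaugeGroup.dist1_mul_le _ _).trans (add_le_add h1 h2)
  · rw [updateFinset_apply_of_not_mem u₀ (y * onFibre s (vΛ u₀)) hc1]
    have h1 := hext i hi c hc hc1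
    linarith

/-- **`FibreRatioClose` OF THE RELATIVE DENSITY, EXPLICIT `κ`, `ε`.**  Under `ReTrQuad G`, for `old = χ·e^{h}`,
`h = Σ_i c_i Re tr U(w_i)`, a background `vΛ` independent of the fibre variables, a window exterior-blind ALONG
RELATIVE FIBRES (`hχ`) and the window smallness `SmallOnRelWindow` at `u₀`:
`FibreRatioClose s (relDensity s vΛ old) u u₀ (rkappa … (vΛ u) (vΛ u₀)) (reps … (vΛ u) (vΛ u₀))`. [folklore] -/
theorem fibreRatioClose_rel_hsum (hq : ReTrQuad G) (s : Finset (PBond P j))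
    {vΛ : GaugeField P j G → GaugeField P j G} (hv : FieldIndep s vΛ) {χ : Density P j G} (hχ0 : ∀ U, 0 ≤ χ U)
    (c : ι → ℝ) (word : ι → List (Letter P j)) (η : ι → ℝ) {u u₀ : GaugeField P j G}
    (hχ : ∀ y : s → G,
      χ (updateFinset u s (y * onFibre s (vΛ u))) = χ (updateFinset u₀ s (y * onFibre s (vΛ u₀))))
    (hW : SmallOnRelWindow s vΛ χ word η u₀) :
    FibreRatioClose s (relDensity s vΛ fun U => χ U * Real.exp (hsum c word U)) u u₀
      (rkappa s c word u u₀ (vΛ u) (vΛ u₀)) (reps s c word η u u₀ (vΛ u) (vΛ u₀)) :=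
  fibreRatioClose_relDensity_of_exp_on s hv hχ0 hχ
    fun y hy => abs_hsum_rel_sub_le hq s c word η u u₀ (vΛ u) (vΛ u₀) y (hW y hy)

/-- **MEMBERSHIP IN pv16-g9's TILT DOMAIN** for the relative density, with the EXPLICIT
`κ u := rkappa … u u₀ (vΛ u) (vΛ u₀)`, `ε u := reps … u u₀ (vΛ u) (vΛ u₀)`. [folklore] -/
theorem mem_tiltDom_rel_hsum (hq : ReTrQuad G) (s : Finset (PBond P j))
    {vΛ : GaugeField P j G → GaugeField P j G} (hv : FieldIndep s vΛ) {χ : Density P j G} (hχ0 : ∀ U, 0 ≤ χ U)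
    (c : ι → ℝ) (word : ι → List (Letter P j)) {η : ι → ℝ} (hη0 : ∀ i, 0 ≤ η i) {u u₀ : GaugeField P j G}
    (hχ : ∀ y : s → G,
      χ (updateFinset u s (y * onFibre s (vΛ u))) = χ (updateFinset u₀ s (y * onFibre s (vΛ u₀))))
    (hW : SmallOnRelWindow s vΛ χ word η u₀) {ε₀ : ℝ} (hε : reps s c word η u u₀ (vΛ u) (vΛ u₀) ≤ ε₀) :
    u ∈ tiltDom s (relDensity s vΛ fun U => χ U * Real.exp (hsum c word U)) u₀
      (fun u => rkappa s c word u u₀ (vΛ u) (vΛ u₀)) (fun u => reps s c word η u u₀ (vΛ u) (vΛ u₀)) ε₀ :=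
  ⟨fibreRatioClose_rel_hsum hq s hv hχ0 c word η hχ hW, reps_nonneg s c word hη0 u u₀ _ _, hε⟩

/-- THE `relWindow` FORM: for `old = relWindow s vΛ w · e^{h}` the window hypothesis holds by construction.
[folklore] -/
theorem mem_tiltDom_relWindow_hsum (hq : ReTrQuad G) (s : Finset (PBond P j))
    {vΛ : GaugeField P j G → GaugeField P j G} (hv : FieldIndep s vΛ) {w : (s → G) → ℝ} (hw : ∀ y, 0 ≤ w y)
    (c : ι → ℝ) (word : ι → List (Letter P j)) {η : ι → ℝ} (hη0 : ∀ i, 0 ≤ η i) {u u₀ : GaugeField P j G}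
    (hW : SmallOnRelWindow s vΛ (relWindow s vΛ w) word η u₀) {ε₀ : ℝ}
    (hε : reps s c word η u u₀ (vΛ u) (vΛ u₀) ≤ ε₀) :
    u ∈ tiltDom s (relDensity s vΛ fun U => relWindow s vΛ w U * Real.exp (hsum c word U)) u₀
      (fun u => rkappa s c word u u₀ (vΛ u) (vΛ u₀)) (fun u => reps s c word η u u₀ (vΛ u) (vΛ u₀)) ε₀ :=
  mem_tiltDom_rel_hsum hq s hv (χ := relWindow s vΛ w) (fun U => hw _) c word hη0
    (fun y => by rw [relWindow_updateFinset_mul s hv, relWindow_updateFinset_mul s hv]) hW hε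

/-- THE WILSON GIBBS FACTOR in the relative coordinate: `old = χ·e^{−βA_w}` (the constant `e^{−β|plaquettes|w}`
joins the window). [folklore] -/
theorem fibreRatioClose_rel_wilsonAction (hq : ReTrQuad G) (s : Finset (PBond P j))
    {vΛ : GaugeField P j G → GaugeField P j G} (hv : FieldIndep s vΛ) {χ : Density P j G} (hχ0 : ∀ U, 0 ≤ χ U)
    (β w : ℝ) (η : Plaq P j → ℝ) {u u₀ : GaugeField P j G}
    (hχ : ∀ y : s → G,
      χ (updateFinset u s (y * onFibre s (vΛ u))) = χ (updateFinset u₀ s (y * onFibre s (vΛ u₀))))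
    (hW : SmallOnRelWindow s vΛ χ plaqWord η u₀) :
    FibreRatioClose s (relDensity s vΛ fun U => χ U * Real.exp (-(β * wilsonAction w U))) u u₀
      (rkappa s (fun _ => β * w) plaqWord u u₀ (vΛ u) (vΛ u₀))
      (reps s (fun _ => β * w) plaqWord η u u₀ (vΛ u) (vΛ u₀)) := by
  have e : (fun U : GaugeField P j G => χ U * Real.exp (-(β * wilsonAction w U)))
      = fun U => (χ U * Real.exp (-(β * (Fintype.card (Plaq P j) * w))))
          * Real.exp (hsum (fun _ => β * w) plaqWord U) := by
    funext U
    rw [exp_neg_mul_wilsonAction, mul_assoc]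
  rw [e]
  refine fibreRatioClose_rel_hsum hq s hv (fun U => mul_nonneg (hχ0 U) (Real.exp_pos _).le) _ _ η
    (fun y => by rw [hχ y]) (fun y hy => hW y fun h0 => hy ?_)
  show χ (updateFinset u₀ s (y * onFibre s (vΛ u₀))) * _ = 0
  rw [h0, zero_mul]

/-- … and membership in the tilt domain of the relative windowed Wilson density. [folklore] -/
theorem mem_tiltDom_rel_wilsonAction (hq : ReTrQuad G) (s : Finset (PBond P j))
    {vΛ : GaugeField P j G → GaugeField P j G} (hv : FieldIndep s vΛ) {χ : Density P j G} (hχ0 : ∀ U, 0 ≤ χ U)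
    (β w : ℝ) {η : Plaq P j → ℝ} (hη0 : ∀ p, 0 ≤ η p) {u u₀ : GaugeField P j G}
    (hχ : ∀ y : s → G,
      χ (updateFinset u s (y * onFibre s (vΛ u))) = χ (updateFinset u₀ s (y * onFibre s (vΛ u₀))))
    (hW : SmallOnRelWindow s vΛ χ plaqWord η u₀) {ε₀ : ℝ}
    (hε : reps s (fun _ => β * w) plaqWord η u u₀ (vΛ u) (vΛ u₀) ≤ ε₀) :
    u ∈ tiltDom s (relDensity s vΛ fun U => χ U * Real.exp (-(β * wilsonAction w U))) u₀
      (fun u => rkappa s (fun _ => β * w) plaqWord u u₀ (vΛ u) (vΛ u₀))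
      (fun u => reps s (fun _ => β * w) plaqWord η u u₀ (vΛ u) (vΛ u₀)) ε₀ :=
  ⟨fibreRatioClose_rel_wilsonAction hq s hv hχ0 β w η hχ hW, reps_nonneg s _ _ hη0 u u₀ _ _, hε⟩

/-- THE `relWindow` WILSON FORM: `old = relWindow s vΛ w · e^{−βA_w}`. [folklore] -/
theorem mem_tiltDom_relWindow_wilsonAction (hq : ReTrQuad G) (s : Finset (PBond P j))
    {vΛ : GaugeField P j G → GaugeField P j G} (hv : FieldIndep s vΛ) {w₀ : (s → G) → ℝ} (hw : ∀ y, 0 ≤ w₀ y)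
    (β w : ℝ) {η : Plaq P j → ℝ} (hη0 : ∀ p, 0 ≤ η p) {u u₀ : GaugeField P j G}
    (hW : SmallOnRelWindow s vΛ (relWindow s vΛ w₀) plaqWord η u₀) {ε₀ : ℝ}
    (hε : reps s (fun _ => β * w) plaqWord η u u₀ (vΛ u) (vΛ u₀) ≤ ε₀) :
    u ∈ tiltDom s (relDensity s vΛ fun U => relWindow s vΛ w₀ U * Real.exp (-(β * wilsonAction w U))) u₀
      (fun u => rkappa s (fun _ => β * w) plaqWord u u₀ (vΛ u) (vΛ u₀))
      (fun u => reps s (fun _ => β * w) plaqWord η u u₀ (vΛ u) (vΛ u₀)) ε₀ :=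
  mem_tiltDom_rel_wilsonAction hq s hv (χ := relWindow s vΛ w₀) (fun U => hw _) β w hη0
    (fun y => by rw [relWindow_updateFinset_mul s hv, relWindow_updateFinset_mul s hv]) hW hε

/-! ### A fully explicit instance: the sharp RELATIVE fibre window -/

/-- **THE EXPLICIT INSTANCE IN THE RELATIVE COORDINATE.**  Under `ReTrQuad G`: for the relative-fibre-windowed Wilson
density `old = relWindow s vΛ (sharpWindow s r) · e^{−βA_w}` with a background `vΛ` independent of the fibre
variables, a reference exterior `u₀` `r`-close to `1` on the exterior letters of the plaquettes meeting `s` and a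
reference background `vΛ(u₀)` `r₀`-close to `1` on the fibre bonds (`0 ≤ r, r₀`), EVERY exterior `u` with
`reps … u u₀ (vΛ u) (vΛ u₀) ≤ ε₀` lies in `tiltDom s (relDensity s vΛ old) u₀ κ ε ε₀` with the explicit `rkappa`,
`reps`, `η ≡ 4(r + r₀)`.  No hypothesis of Bałaban's is used; nothing printed is asserted. [folklore] -/
theorem mem_tiltDom_relFibreWindow_wilson (hq : ReTrQuad G) (s : Finset (PBond P j))
    {vΛ : GaugeField P j G → GaugeField P j G} (hv : FieldIndep s vΛ) {r r₀ : ℝ} (hr : 0 ≤ r) (hr0 : 0 ≤ r₀)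
    (β w : ℝ) {u u₀ : GaugeField P j G} (hbg : ∀ b ∈ s, dist1 (vΛ u₀ b) ≤ r₀)
    (hext : ∀ p : Plaq P j, Meets s (plaqWord p) → ∀ c ∈ plaqWord p, c.1 ∉ s → dist1 (u₀ c.1) ≤ r) {ε₀ : ℝ}
    (hε : reps s (fun _ => β * w) plaqWord (fun _ => 4 * (r + r₀)) u u₀ (vΛ u) (vΛ u₀) ≤ ε₀) :
    u ∈ tiltDom s (relDensity s vΛ fun U => relWindow s vΛ (sharpWindow s r) U * Real.exp (-(β * wilsonAction w U)))
      u₀ (fun u => rkappa s (fun _ => β * w) plaqWord u u₀ (vΛ u) (vΛ u₀))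
      (fun u => reps s (fun _ => β * w) plaqWord (fun _ => 4 * (r + r₀)) u u₀ (vΛ u) (vΛ u₀)) ε₀ := by
  have hW : SmallOnRelWindow s vΛ (relWindow s vΛ (sharpWindow s r)) plaqWord
      (fun _ => 4 * (r + r₀)) u₀ := by
    intro y hy p hp
    have h := smallOnRelWindow_of_bondSmall (word := plaqWord) hv hr0
      (fun y hy => sharpWindow_support hy) hbg hext y hy p hp
    simpa only [length_plaqWord, Nat.cast_ofNat] using h
  exact mem_tiltDom_relWindow_wilsonAction hq s hv (sharpWindow_nonneg s r) β w
    (fun _ => by nlinarith) hW hε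

open Literature.MathematicalPhysics.QuantumLattice in
/-- **THE EXPLICIT INSTANCE IN `SU(n)`**: `ReTrQuad` discharged by `reTrQuad_specialUnitaryGroup`; the only
hypotheses left are `FieldIndep s vΛ` (U1a input) and the numeric ones. [folklore] -/
theorem mem_tiltDom_relFibreWindow_wilson_SU {n : Type*} [Fintype n] [DecidableEq n] [Nonempty n]
    (s : Finset (PBond P j))
    {vΛ : GaugeField P j (Matrix.specialUnitaryGroup n ℂ) → GaugeField P j (Matrix.specialUnitaryGroup n ℂ)}
    (hv : FieldIndep s vΛ) {r r₀ : ℝ} (hr : 0 ≤ r) (hr0 : 0 ≤ r₀) (β w : ℝ)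
    {u u₀ : GaugeField P j (Matrix.specialUnitaryGroup n ℂ)} (hbg : ∀ b ∈ s, dist1 (vΛ u₀ b) ≤ r₀)
    (hext : ∀ p : Plaq P j, Meets s (plaqWord p) → ∀ c ∈ plaqWord p, c.1 ∉ s → dist1 (u₀ c.1) ≤ r) {ε₀ : ℝ}
    (hε : reps s (fun _ => β * w) plaqWord (fun _ => 4 * (r + r₀)) u u₀ (vΛ u) (vΛ u₀) ≤ ε₀) :
    u ∈ tiltDom s (relDensity s vΛ fun U => relWindow s vΛ (sharpWindow s r) U * Real.exp (-(β * wilsonAction w U)))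
      u₀ (fun u => rkappa s (fun _ => β * w) plaqWord u u₀ (vΛ u) (vΛ u₀))
      (fun u => reps s (fun _ => β * w) plaqWord (fun _ => 4 * (r + r₀)) u u₀ (vΛ u) (vΛ u₀)) ε₀ :=
  mem_tiltDom_relFibreWindow_wilson reTrQuad_specialUnitaryGroup s hv hr hr0 β w hbg hext hε

end Discharge

end Literature.MathematicalPhysics.QuantumFieldTheory.Balaban1983to89.T4TiltOscillationRel

end
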